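import Literature.AlgebraicTopology.CharacteristicClasses.ProjectiveCompletionMap
import HarnessLib

/-!
# The two halves `P(ξ ⊕ ℂ) ∖ P(ξ)_∞` and `P(ξ ⊕ ℂ) ∖ s₀(B)` of the projective completion, and `E₀`

J. Milnor, J. Stasheff, *Characteristic Classes* (1974), §9–§12 (the pair `(E, E₀)`, `E₀ = E ∖ s₀(B)`,
and the Gysin sequence), in the projective-completion model `D = P(ξ ⊕ ℂ)` of the Thom space
(R. Bott, L. Tu, *Differential Forms in Algebraic Topology*, §6/§12; D. Husemoller, *Fibre Bundles*,
Ch. 17): the completion is covered by the two open sets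

* `finitePart = {⟨b, [v : τ]⟩ | τ ≠ 0}` — the complement of the hyperplane (for lines: section)
  at infinity, identified with the total space `E(ξ)` by `v ↦ [v : 1]` (`complEmbed`,
  `complEmbed_continuous`, inverse `complRetract ⟨b, ℓ⟩ = τ⁻¹ v`, `continuousOn_complRetract`);
* `vectorPart = {⟨b, [v : τ]⟩ | v ≠ 0}` — the complement of the zero section `s₀(B)`;

with `finitePart ∪ vectorPart = D`, `s₀(B) ⊆ finitePart`, `s_∞(B) ⊆ vectorPart`,
`s₀(B) ∩ vectorPart = ∅ = s_∞(B) ∩ finitePart`, and **`finitePart ∩ vectorPart ≃ₜ E₀ = E ∖ s₀(B)`**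
(`puncturedHomeomorph`). These are the sets of the Mayer–Vietoris argument computing the Euler
class of the tautological line bundle (sequel).

Everything is proved; no named facts.

## References

* J. Milnor, J. Stasheff, *Characteristic Classes*, PUP 1974, §9, §12. [MilnorStasheff1974]
* D. Husemoller, *Fibre Bundles*, GTM 20, Springer 1994, Ch. 17 §2. [HusemollerFibreBundles1994]
-/

noncomputable section

open Function Set Filter Bundle Topology Trivialization
open scoped LinearAlgebra.Projectivization

universe u

namespace Literature.AlgebraicTopology.CharacteristicClasses

/-! ### Points of `ℙ(V ⊕ ℂ)`: finite points and the two distinguished predicates -/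

section Points

variable {V : Type u} [AddCommGroup V] [Module ℂ V]

/-- `[v : τ] = [0 : 1] ↔ v = 0`. [folklore] -/
theorem mk_eq_zeroPt_iff (v : V) (τ : ℂ) (h : ((v, τ) : V × ℂ) ≠ 0) :
    Projectivization.mk ℂ (v, τ) h = zeroPt V ↔ v = 0 := by
  rw [zeroPt, Projectivization.mk_eq_mk_iff]
  constructor
  · rintro ⟨a, ha⟩
    have := congrArg Prod.fst ha
    simpa using this.symm
  · intro hv
    subst hv
    have hτ : τ ≠ 0 := fun hτ ↦ h (by rw [hτ]; rfl)
    exact ⟨Units.mk0 τ hτ, by ext <;> simp⟩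

/-- `[v : τ]` is a finite point (`τ ≠ 0`) iff it lies in the affine chart of the functional `snd`. [folklore] -/
theorem mk_mem_chartDomain_snd_iff (v : V) (τ : ℂ) (h : ((v, τ) : V × ℂ) ≠ 0) :
    Projectivization.mk ℂ (v, τ) h ∈ chartDomain (LinearMap.snd ℂ V ℂ) ↔ τ ≠ 0 :=
  mk_mem_chartDomain_iff _ _ h

/-- The normalised representative of a finite point: `affineRep snd [v : τ] = (τ⁻¹ v, 1)`-ish, first
coordinate `τ⁻¹ • v`. [folklore] -/
theorem fst_affineRep_snd_mk (v : V) (τ : ℂ) (h : ((v, τ) : V × ℂ) ≠ 0) :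
    (affineRep (LinearMap.snd ℂ V ℂ) (Projectivization.mk ℂ (v, τ) h)).1 = τ⁻¹ • v := by
  rw [affineRep_mk]
  rfl

/-- `[v : 1]` has normalised representative with first coordinate `v`. [folklore] -/
theorem fst_affineRep_snd_mk_one (v : V) (h : ((v, (1 : ℂ)) : V × ℂ) ≠ 0) :
    (affineRep (LinearMap.snd ℂ V ℂ) (Projectivization.mk ℂ (v, (1 : ℂ)) h)).1 = v := by
  rw [fst_affineRep_snd_mk, inv_one, one_smul]

/-- A finite point is recovered from its normalised representative: `[(affineRep snd ℓ).1 : 1] = ℓ`. [folklore] -/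
theorem mk_fst_affineRep_snd {ℓ : ℙ ℂ (V × ℂ)} (hℓ : ℓ ∈ chartDomain (LinearMap.snd ℂ V ℂ))
    (h : (((affineRep (LinearMap.snd ℂ V ℂ) ℓ).1, (1 : ℂ)) : V × ℂ) ≠ 0) :
    Projectivization.mk ℂ ((affineRep (LinearMap.snd ℂ V ℂ) ℓ).1, (1 : ℂ)) h = ℓ := by
  have h2 : (affineRep (LinearMap.snd ℂ V ℂ) ℓ).2 = 1 := apply_affineRep _ hℓ
  have heq : ((affineRep (LinearMap.snd ℂ V ℂ) ℓ).1, (1 : ℂ)) = affineRep (LinearMap.snd ℂ V ℂ) ℓ :=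
    Prod.ext rfl h2.symm
  simp_rw [heq]
  exact mk_affineRep _ hℓ

/-- Linear isomorphisms `A × 𝟙` commute with the normalised representative of the chart `snd`:
`affineRep snd (ℙ(A × 𝟙) ℓ) = (A × 𝟙) (affineRep snd ℓ)` (first coordinates). [folklore] -/
theorem fst_affineRep_snd_map {W : Type u} [AddCommGroup W] [Module ℂ W] (A : V →ₗ[ℂ] W) (hA : Injective A)
    (ℓ : ℙ ℂ (V × ℂ)) :
    (affineRep (LinearMap.snd ℂ W ℂ)
        (Projectivization.map (A.prodMap (LinearMap.id : ℂ →ₗ[ℂ] ℂ)) (hA.prodMap injective_id) ℓ)).1 =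
      A (affineRep (LinearMap.snd ℂ V ℂ) ℓ).1 := by
  induction ℓ using Projectivization.ind with
  | h w hw =>
    obtain ⟨v, τ⟩ := w
    rw [Projectivization.map_mk, fst_affineRep_snd_mk]
    change ((LinearMap.id : ℂ →ₗ[ℂ] ℂ) τ)⁻¹ • A v = A ((τ⁻¹ • (v, τ)).1)
    rw [LinearMap.id_apply, Prod.smul_fst, map_smul]

/-- `ℙ(A × 𝟙)` preserves finiteness of points. [folklore] -/
theorem map_mem_chartDomain_snd_iff {W : Type u} [AddCommGroup W] [Module ℂ W] (A : V →ₗ[ℂ] W) (hA : Injective A)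
    (ℓ : ℙ ℂ (V × ℂ)) :
    Projectivization.map (A.prodMap (LinearMap.id : ℂ →ₗ[ℂ] ℂ)) (hA.prodMap injective_id) ℓ ∈
        chartDomain (LinearMap.snd ℂ W ℂ) ↔ ℓ ∈ chartDomain (LinearMap.snd ℂ V ℂ) := by
  induction ℓ using Projectivization.ind with
  | h w hw =>
    obtain ⟨v, τ⟩ := w
    rw [Projectivization.map_mk]
    exact (mk_mem_chartDomain_snd_iff (A v) τ _).trans (mk_mem_chartDomain_snd_iff v τ hw).symm

/-- `ℙ(A × 𝟙)` preserves the point `[0 : 1]` and only it maps there. [folklore] -/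
theorem map_eq_zeroPt_iff {W : Type u} [AddCommGroup W] [Module ℂ W] (A : V →ₗ[ℂ] W) (hA : Injective A)
    (ℓ : ℙ ℂ (V × ℂ)) :
    Projectivization.map (A.prodMap (LinearMap.id : ℂ →ₗ[ℂ] ℂ)) (hA.prodMap injective_id) ℓ = zeroPt W ↔
      ℓ = zeroPt V := by
  induction ℓ using Projectivization.ind with
  | h w hw =>
    obtain ⟨v, τ⟩ := w
    rw [Projectivization.map_mk]
    exact (mk_eq_zeroPt_iff (A v) τ _).trans ((map_eq_zero_iff A hA).trans (mk_eq_zeroPt_iff v τ hw).symm)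

end Points

section PartsDefs

variable {B : Type u} (F : Type u) [NormedAddCommGroup F] [NormedSpace ℂ F]
  (E : B → Type u) [∀ b, AddCommGroup (E b)] [∀ b, Module ℂ (E b)]

/-- **The finite part `{⟨b, [v : τ]⟩ | τ ≠ 0} = P(ξ ⊕ ℂ) ∖ P(ξ)_∞`.** [cite: MilnorStasheff1974, §12] -/
def finitePart : Set (ProjCompl F E) := {p | p.2 ∈ chartDomain (LinearMap.snd ℂ (E p.proj) ℂ)}

/-- **The vector part `{⟨b, [v : τ]⟩ | v ≠ 0} = P(ξ ⊕ ℂ) ∖ s₀(B)`.** [cite: MilnorStasheff1974, §12] -/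
def vectorPart : Set (ProjCompl F E) := {p | p.2 ≠ zeroPt (E p.proj)}

variable {F E}

/-- Membership in the finite part. [folklore] -/
theorem mem_finitePart_iff (p : ProjCompl F E) : p ∈ finitePart F E ↔ p.2 ∈ chartDomain (LinearMap.snd ℂ (E p.proj) ℂ) :=
  Iff.rfl

/-- Membership in the vector part. [folklore] -/
theorem mem_vectorPart_iff (p : ProjCompl F E) : p ∈ vectorPart F E ↔ p.2 ≠ zeroPt (E p.proj) := Iff.rfl

/-- `⟨b, [v : τ]⟩` is in the finite part iff `τ ≠ 0`. [folklore] -/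
theorem mk_mem_finitePart_iff (b : B) (v : E b) (τ : ℂ) (h : ((v, τ) : E b × ℂ) ≠ 0) :
    (⟨b, Projectivization.mk ℂ (v, τ) h⟩ : ProjCompl F E) ∈ finitePart F E ↔ τ ≠ 0 :=
  mk_mem_chartDomain_snd_iff v τ h

/-- `⟨b, [v : τ]⟩` is in the vector part iff `v ≠ 0`. [folklore] -/
theorem mk_mem_vectorPart_iff (b : B) (v : E b) (τ : ℂ) (h : ((v, τ) : E b × ℂ) ≠ 0) :
    (⟨b, Projectivization.mk ℂ (v, τ) h⟩ : ProjCompl F E) ∈ vectorPart F E ↔ v ≠ 0 :=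
  (mk_eq_zeroPt_iff v τ h).not

variable (F E)

/-- **The two parts cover.** [cite: MilnorStasheff1974, §12] -/
theorem finitePart_union_vectorPart : finitePart F E ∪ vectorPart F E = univ := by
  refine eq_univ_of_forall fun p ↦ ?_
  obtain ⟨b, ℓ⟩ := p
  induction ℓ using Projectivization.ind with
  | h w hw =>
    obtain ⟨v, τ⟩ := w
    by_cases hτ : τ = 0
    · refine Or.inr ((mk_mem_vectorPart_iff b v τ hw).2 fun hv ↦ hw ?_)
      rw [hv, hτ]
      rfl
    · exact Or.inl ((mk_mem_finitePart_iff b v τ hw).2 hτ)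

end PartsDefs

section Parts

variable {B : Type u} [TopologicalSpace B] (F : Type u) [NormedAddCommGroup F] [NormedSpace ℂ F] [FiniteDimensional ℂ F]
  (E : B → Type u) [∀ b, AddCommGroup (E b)] [∀ b, Module ℂ (E b)]
  [TopologicalSpace (TotalSpace F E)] [∀ b, TopologicalSpace (E b)] [FiberBundle F E] [VectorBundle ℂ F E]

/-- The zero section lies in the finite part. [folklore] -/
theorem complZero_mem_finitePart (b : B) : complZero F E b ∈ finitePart F E := by
  rw [complZero_apply, zeroPt]
  exact (mk_mem_finitePart_iff b 0 1 _).2 one_ne_zero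

/-- The zero section misses the vector part. [folklore] -/
theorem complZero_not_mem_vectorPart (b : B) : complZero F E b ∉ vectorPart F E := fun h ↦ h rfl

/-- The section at infinity lies in the vector part (line bundles). [folklore] -/
theorem complInf_mem_vectorPart (hF : Module.finrank ℂ F = 1) (b : B) : complInf F E hF b ∈ vectorPart F E := by
  rw [complInf_apply, infPt]
  exact (mk_mem_vectorPart_iff b _ 0 _).2 (fibreVec_ne_zero F E hF b)

/-- The section at infinity misses the finite part (line bundles). [folklore] -/
theorem complInf_not_mem_finitePart (hF : Module.finrank ℂ F = 1) (b : B) : complInf F E hF b ∉ finitePart F E := by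
  rw [complInf_apply, infPt]
  exact fun h ↦ (mk_mem_finitePart_iff b _ 0 _).1 h rfl

/-! ### Openness, through the canonical charts -/

variable {F E} in
/-- A subset of `P(ξ ⊕ ℂ)` read, in every canonical chart, as `U × W` for a fixed open `W` of the
model fibre is open. [folklore] -/
theorem isOpen_of_forall_trivializationAt (S : Set (ProjCompl F E)) (W : Set (ℙ ℂ (F × ℂ))) (hW : IsOpen W)
    (h : ∀ (b₀ : B) (p : ProjCompl F E), p ∈ (trivializationAt (ℙ ℂ (F × ℂ)) (fun b ↦ ℙ ℂ (ComplFib E b)) b₀).source →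
      (p ∈ S ↔ (trivializationAt (ℙ ℂ (F × ℂ)) (fun b ↦ ℙ ℂ (ComplFib E b)) b₀ p).2 ∈ W)) :
    IsOpen S := by
  have hS : S = ⋃ b₀ : B, (trivializationAt (ℙ ℂ (F × ℂ)) (fun b ↦ ℙ ℂ (ComplFib E b)) b₀).source ∩
      (trivializationAt (ℙ ℂ (F × ℂ)) (fun b ↦ ℙ ℂ (ComplFib E b)) b₀) ⁻¹' (univ ×ˢ W) := by
    ext p
    simp only [mem_iUnion, mem_inter_iff, mem_preimage, mem_prod, mem_univ, true_and]
    constructor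
    · intro hp
      exact ⟨p.proj, FiberBundle.mem_trivializationAt_proj_source, (h p.proj p FiberBundle.mem_trivializationAt_proj_source).1 hp⟩
    · rintro ⟨b₀, hsrc, hw⟩
      exact (h b₀ p hsrc).2 hw
  rw [hS]
  exact isOpen_iUnion fun b₀ ↦ (trivializationAt _ _ b₀).continuousOn_toFun.isOpen_inter_preimage
    (trivializationAt _ _ b₀).open_source (isOpen_univ.prod hW)

/-- In the canonical chart at `b₀` the fibre coordinate of `⟨b, ℓ⟩` is `ℙ(ẽ_b × 𝟙) ℓ`. [folklore] -/
theorem trivializationAt_compl_apply_snd_eq {b₀ : B} (p : ProjCompl F E)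
    (hp : p.proj ∈ (trivializationAt F E b₀).baseSet) :
    (trivializationAt (ℙ ℂ (F × ℂ)) (fun b ↦ ℙ ℂ (ComplFib E b)) b₀ p).2 =
      Projectivization.map ((((linEquivAt ℂ F E (trivializationAt F E b₀) p.proj) : E p.proj →L[ℂ] F) :
          E p.proj →ₗ[ℂ] F).prodMap (LinearMap.id : ℂ →ₗ[ℂ] ℂ))
        ((linEquivAt ℂ F E (trivializationAt F E b₀) p.proj).injective.prodMap injective_id) p.2 := by
  rw [trivializationAt_compl_apply_snd]
  induction p.2 using Projectivization.ind with
  | h w hw =>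
    simp only [Projectivization.map_mk]
    exact mk_congr_vec (linEquivAt_prodTriv_apply (trivializationAt F E b₀) hp w) _ _

/-- The source of the canonical chart of `P(ξ ⊕ ℂ)` at `b₀` is `π⁻¹(U_{b₀})`. [folklore] -/
theorem mem_trivializationAt_compl_source_iff {b₀ : B} (p : ProjCompl F E) :
    p ∈ (trivializationAt (ℙ ℂ (F × ℂ)) (fun b ↦ ℙ ℂ (ComplFib E b)) b₀).source ↔
      p.proj ∈ (trivializationAt F E b₀).baseSet := by
  rw [(trivializationAt (ℙ ℂ (F × ℂ)) (fun b ↦ ℙ ℂ (ComplFib E b)) b₀).mem_source]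
  change p.proj ∈ (trivializationAt F E b₀).baseSet ∩ univ ↔ _
  rw [inter_univ]

/-- **The finite part is open.** [cite: MilnorStasheff1974, §12] -/
theorem isOpen_finitePart : IsOpen (finitePart F E) := by
  refine isOpen_of_forall_trivializationAt _ (chartDomain (LinearMap.snd ℂ F ℂ))
    (isOpen_chartDomain _ (ContinuousLinearMap.snd ℂ F ℂ).continuous) fun b₀ p hp ↦ ?_
  rw [trivializationAt_compl_apply_snd_eq F E p ((mem_trivializationAt_compl_source_iff F E p).1 hp)]
  exact (map_mem_chartDomain_snd_iff _ (linEquivAt ℂ F E (trivializationAt F E b₀) p.proj).injective p.2).symm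

/-- **The vector part is open.** [cite: MilnorStasheff1974, §12] -/
theorem isOpen_vectorPart : IsOpen (vectorPart F E) := by
  haveI : T2Space (ℙ ℂ (F × ℂ)) := t2Space_of_finiteDimensional ℂ (F × ℂ)
  refine isOpen_of_forall_trivializationAt _ ({zeroPt F}ᶜ) isOpen_compl_singleton fun b₀ p hp ↦ ?_
  rw [mem_compl_singleton_iff,
    trivializationAt_compl_apply_snd_eq F E p ((mem_trivializationAt_compl_source_iff F E p).1 hp)]
  exact (map_eq_zeroPt_iff _ (linEquivAt ℂ F E (trivializationAt F E b₀) p.proj).injective p.2).not.symm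

/-! ### `E ↪ P(ξ ⊕ ℂ)`, `v ↦ [v : 1]`, and its inverse on the finite part -/

/-- `(v, 1) ≠ 0`. [folklore] -/
theorem pair_one_ne_zero {V : Type u} [AddCommGroup V] [Module ℂ V] (v : V) : ((v, (1 : ℂ)) : V × ℂ) ≠ 0 := by simp

/-- **The open embedding `E(ξ) → P(ξ ⊕ ℂ)`, `⟨b, v⟩ ↦ ⟨b, [v : 1]⟩`** (as a function). [cite: MilnorStasheff1974, §12] -/
def complEmbed (v : TotalSpace F E) : ProjCompl F E := ⟨v.proj, Projectivization.mk ℂ (v.2, (1 : ℂ)) (pair_one_ne_zero v.2)⟩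

omit [TopologicalSpace B] [FiniteDimensional ℂ F] [TopologicalSpace (TotalSpace F E)] [∀ b, TopologicalSpace (E b)]
  [FiberBundle F E] [VectorBundle ℂ F E] in
/-- `complEmbed` covers the identity. [folklore] -/
@[simp]
theorem complEmbed_proj (v : TotalSpace F E) : (complEmbed F E v).proj = v.proj := rfl

omit [TopologicalSpace B] [FiniteDimensional ℂ F] [TopologicalSpace (TotalSpace F E)] [∀ b, TopologicalSpace (E b)]
  [FiberBundle F E] [VectorBundle ℂ F E] in
/-- `complEmbed` lands in the finite part. [folklore] -/
theorem complEmbed_mem_finitePart (v : TotalSpace F E) : complEmbed F E v ∈ finitePart F E :=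
  (mk_mem_finitePart_iff v.proj v.2 1 _).2 one_ne_zero

omit [TopologicalSpace B] [FiniteDimensional ℂ F] [TopologicalSpace (TotalSpace F E)] [∀ b, TopologicalSpace (E b)]
  [FiberBundle F E] [VectorBundle ℂ F E] in
/-- `complEmbed v` is in the vector part iff `v ≠ 0`. [folklore] -/
theorem complEmbed_mem_vectorPart_iff (v : TotalSpace F E) : complEmbed F E v ∈ vectorPart F E ↔ v.2 ≠ 0 :=
  mk_mem_vectorPart_iff v.proj v.2 1 _

/-- `[f x]` depends continuously on `x` at a point where `f` is continuous and nowhere zero. [folklore] -/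
theorem _root_.ContinuousAt.projectivizationMk {X : Type*} [TopologicalSpace X] {V : Type u} [AddCommGroup V]
    [Module ℂ V] [TopologicalSpace V] {f : X → V} {x₀ : X} (hf : ContinuousAt f x₀) (h : ∀ x, f x ≠ 0) :
    ContinuousAt (fun x ↦ Projectivization.mk ℂ (f x) (h x)) x₀ :=
  (Projectivization.continuous_mk'.continuousAt).comp (hf.codRestrict (t := {w : V | w ≠ 0}) h)

/-- **`complEmbed` is continuous**: in the canonical charts it is `(b, x) ↦ (b, [x : 1])`.
[cite: MilnorStasheff1974, §12] -/
theorem continuous_complEmbed : Continuous (complEmbed F E) := by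
  refine continuous_iff_continuousAt.2 fun v₀ ↦ ?_
  rw [FiberBundle.continuousAt_totalSpace]
  refine ⟨(FiberBundle.continuous_proj F E).continuousAt, ?_⟩
  set b₀ := v₀.proj
  set e := trivializationAt F E b₀ with he
  -- near `v₀` the fibre coordinate is `[(e v).2 : 1]`
  have hev : ∀ᶠ v in 𝓝 v₀, v.proj ∈ e.baseSet :=
    (FiberBundle.continuous_proj F E).continuousAt.preimage_mem_nhds
      (e.open_baseSet.mem_nhds (FiberBundle.mem_baseSet_trivializationAt F E b₀))
  have hloc : (fun v : TotalSpace F E ↦ (trivializationAt (ℙ ℂ (F × ℂ)) (fun b ↦ ℙ ℂ (ComplFib E b))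
      (complEmbed F E v₀).proj (complEmbed F E v)).2) =ᶠ[𝓝 v₀]
        fun v ↦ Projectivization.mk ℂ ((e v).2, (1 : ℂ)) (pair_one_ne_zero _) := by
    filter_upwards [hev] with v hv
    change (trivializationAt (ℙ ℂ (F × ℂ)) (fun b ↦ ℙ ℂ (ComplFib E b)) b₀ (complEmbed F E v)).2 = _
    rw [trivializationAt_compl_apply_snd_eq F E (complEmbed F E v) hv, complEmbed, Projectivization.map_mk]
    congr 1
    exact Prod.ext (linEquivAt_apply (K := ℂ) e hv v.2) rfl
  rw [continuousAt_congr hloc]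
  refine ContinuousAt.projectivizationMk ?_ _
  exact ((continuous_snd.continuousAt).comp (e.continuousAt FiberBundle.mem_trivializationAt_proj_source)).prodMk
    continuousAt_const

/-- **The inverse `P(ξ ⊕ ℂ) ⊇ finitePart → E(ξ)`, `⟨b, [v : τ]⟩ ↦ ⟨b, τ⁻¹ v⟩`** (total on `P(ξ ⊕ ℂ)`, junk
off the finite part). [cite: MilnorStasheff1974, §12] -/
def complRetract (p : ProjCompl F E) : TotalSpace F E := ⟨p.proj, (affineRep (LinearMap.snd ℂ (E p.proj) ℂ) p.2).1⟩

omit [TopologicalSpace B] [FiniteDimensional ℂ F] [TopologicalSpace (TotalSpace F E)] [∀ b, TopologicalSpace (E b)]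
  [FiberBundle F E] [VectorBundle ℂ F E] in
/-- `complRetract` covers the identity. [folklore] -/
@[simp]
theorem complRetract_proj (p : ProjCompl F E) : (complRetract F E p).proj = p.proj := rfl

omit [TopologicalSpace B] [FiniteDimensional ℂ F] [TopologicalSpace (TotalSpace F E)] [∀ b, TopologicalSpace (E b)]
  [FiberBundle F E] [VectorBundle ℂ F E] in
/-- `complRetract ∘ complEmbed = id`. [folklore] -/
@[simp]
theorem complRetract_complEmbed (v : TotalSpace F E) : complRetract F E (complEmbed F E v) = v := by
  obtain ⟨b, y⟩ := v
  change (⟨b, (affineRep (LinearMap.snd ℂ (E b) ℂ) (Projectivization.mk ℂ (y, (1 : ℂ)) _)).1⟩ : TotalSpace F E) = ⟨b, y⟩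
  rw [fst_affineRep_snd_mk_one]

omit [TopologicalSpace B] [FiniteDimensional ℂ F] [TopologicalSpace (TotalSpace F E)] [∀ b, TopologicalSpace (E b)]
  [FiberBundle F E] [VectorBundle ℂ F E] in
/-- `complEmbed ∘ complRetract = id` on the finite part. [folklore] -/
theorem complEmbed_complRetract {p : ProjCompl F E} (hp : p ∈ finitePart F E) : complEmbed F E (complRetract F E p) = p := by
  obtain ⟨b, ℓ⟩ := p
  change (⟨b, Projectivization.mk ℂ ((affineRep (LinearMap.snd ℂ (E b) ℂ) ℓ).1, (1 : ℂ)) _⟩ : ProjCompl F E) = ⟨b, ℓ⟩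
  rw [mk_fst_affineRep_snd hp]

omit [TopologicalSpace B] [FiniteDimensional ℂ F] [TopologicalSpace (TotalSpace F E)] [∀ b, TopologicalSpace (E b)]
  [FiberBundle F E] [VectorBundle ℂ F E] in
/-- The finite part is the image of `complEmbed`. [folklore] -/
theorem finitePart_eq_range_complEmbed : finitePart F E = range (complEmbed F E) := by
  refine Subset.antisymm (fun p hp ↦ ⟨complRetract F E p, complEmbed_complRetract F E hp⟩) ?_
  rintro _ ⟨v, rfl⟩
  exact complEmbed_mem_finitePart F E v

/-- **`complRetract` is continuous on the finite part**: in the canonical charts it is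
`(b, ℓ) ↦ (b, (affineRep snd ℓ).1)`. [cite: MilnorStasheff1974, §12] -/
theorem continuousOn_complRetract : ContinuousOn (complRetract F E) (finitePart F E) := by
  intro p₀ hp₀
  rw [FiberBundle.continuousWithinAt_totalSpace]
  refine ⟨(continuous_projProj ℂ (F × ℂ) (ComplFib E)).continuousWithinAt, ?_⟩
  set b₀ := p₀.proj
  set e := trivializationAt F E b₀ with he
  set T := trivializationAt (ℙ ℂ (F × ℂ)) (fun b ↦ ℙ ℂ (ComplFib E b)) b₀ with hT
  have hev : ∀ᶠ p in 𝓝[finitePart F E] p₀, p.proj ∈ e.baseSet ∧ p ∈ finitePart F E := by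
    refine Filter.inter_mem (mem_nhdsWithin_of_mem_nhds ?_) self_mem_nhdsWithin
    exact (continuous_projProj ℂ (F × ℂ) (ComplFib E)).continuousAt.preimage_mem_nhds
      (e.open_baseSet.mem_nhds (FiberBundle.mem_baseSet_trivializationAt F E b₀))
  have hloc : (fun p : ProjCompl F E ↦ (trivializationAt F E (complRetract F E p₀).proj (complRetract F E p)).2)
      =ᶠ[𝓝[finitePart F E] p₀] fun p ↦ (affineRep (LinearMap.snd ℂ F ℂ) (T p).2).1 := by
    filter_upwards [hev] with p hp
    change (e (complRetract F E p)).2 = _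
    rw [complRetract, ← linEquivAt_apply (K := ℂ) e hp.1, hT, trivializationAt_compl_apply_snd_eq F E p hp.1]
    exact (fst_affineRep_snd_map _ (linEquivAt ℂ F E (trivializationAt F E b₀) p.proj).injective p.2).symm
  rw [hloc.congr_continuousWithinAt_of_mem hp₀]
  -- `p ↦ (affineRep snd (T p).2).1` is continuous within the finite part at `p₀`
  have hT0 : ContinuousWithinAt (fun p : ProjCompl F E ↦ (T p).2) (finitePart F E) p₀ :=
    (continuous_snd.continuousAt.comp (T.continuousAt FiberBundle.mem_trivializationAt_proj_source)).continuousWithinAt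
  have hmaps : MapsTo (fun p : ProjCompl F E ↦ (T p).2) (finitePart F E ∩ T.source) (chartDomain (LinearMap.snd ℂ F ℂ)) := by
    rintro p ⟨hp, hps⟩
    change (T p).2 ∈ chartDomain (LinearMap.snd ℂ F ℂ)
    rw [hT, trivializationAt_compl_apply_snd_eq F E p ((mem_trivializationAt_compl_source_iff F E p).1 hps)]
    exact (map_mem_chartDomain_snd_iff _ (linEquivAt ℂ F E (trivializationAt F E b₀) p.proj).injective p.2).2 hp
  have hin : T.source ∈ 𝓝[finitePart F E] p₀ :=
    mem_nhdsWithin_of_mem_nhds (T.open_source.mem_nhds FiberBundle.mem_trivializationAt_proj_source)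
  have h1 : ContinuousWithinAt (fun p : ProjCompl F E ↦ affineRep (LinearMap.snd ℂ F ℂ) (T p).2) (finitePart F E) p₀ := by
    have h2 : ContinuousWithinAt (fun p : ProjCompl F E ↦ affineRep (LinearMap.snd ℂ F ℂ) (T p).2)
        (finitePart F E ∩ T.source) p₀ :=
      ContinuousWithinAt.comp (f := fun p : ProjCompl F E ↦ (T p).2) (g := affineRep (LinearMap.snd ℂ F ℂ)) (x := p₀)
        ((continuousOn_affineRep (LinearMap.snd ℂ F ℂ) (ContinuousLinearMap.snd ℂ F ℂ).continuous) _
          (hmaps ⟨hp₀, FiberBundle.mem_trivializationAt_proj_source⟩))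
        (hT0.mono inter_subset_left) hmaps
    exact (continuousWithinAt_inter' hin).1 h2
  exact continuous_fst.continuousAt.comp_continuousWithinAt h1

/-! ### `finitePart ∩ vectorPart ≃ₜ E₀` -/

/-- **The punctured total space `E₀ = E ∖ s₀(B)` is homeomorphic to `finitePart ∩ vectorPart ⊆ P(ξ ⊕ ℂ)`**
(`v ↦ [v : 1]`, inverse `[v : τ] ↦ τ⁻¹ v`). [cite: MilnorStasheff1974, §12] -/
def puncturedHomeomorph : {v : TotalSpace F E // v.2 ≠ 0} ≃ₜ ↥(finitePart F E ∩ vectorPart F E) where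
  toFun v := ⟨complEmbed F E v.1, complEmbed_mem_finitePart F E v.1, (complEmbed_mem_vectorPart_iff F E v.1).2 v.2⟩
  invFun p := ⟨complRetract F E p.1, by
    intro h0
    apply p.2.2
    have := complEmbed_complRetract F E p.2.1
    rw [← this]
    change Projectivization.mk ℂ ((complRetract F E p.1).2, (1 : ℂ)) _ = zeroPt _
    exact (mk_eq_zeroPt_iff _ _ _).2 h0⟩
  left_inv v := Subtype.ext (complRetract_complEmbed F E v.1)
  right_inv p := Subtype.ext (complEmbed_complRetract F E p.2.1)
  continuous_toFun := ((continuous_complEmbed F E).comp continuous_subtype_val).subtype_mk _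
  continuous_invFun := by
    refine Continuous.subtype_mk ?_ _
    have h := (continuousOn_complRetract F E).mono (inter_subset_left (t := vectorPart F E))
    rw [continuousOn_iff_continuous_restrict] at h
    exact h

/-- The homeomorphism on points. [folklore] -/
@[simp]
theorem puncturedHomeomorph_apply_coe (v : {v : TotalSpace F E // v.2 ≠ 0}) :
    (puncturedHomeomorph F E v : ProjCompl F E) = complEmbed F E v.1 := rfl

/-- **The finite and vector parts are open, cover, and meet in `E₀`** — summary of the Mayer–Vietoris
data. [cite: MilnorStasheff1974, §12] -/
theorem isOpen_finitePart_inter_vectorPart : IsOpen (finitePart F E ∩ vectorPart F E) :=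
  (isOpen_finitePart F E).inter (isOpen_vectorPart F E)

end Parts

end Literature.AlgebraicTopology.CharacteristicClasses
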